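import Summits.QuantumFields.YangMills.Theorems.BalabanUVNodesN12TowerForestWords
import Summits.QuantumFields.YangMills.Theorems.BalabanUVNodesN12BjAcrossChainsLam
import HarnessLib

/-!
# BalabanUVNodes ∕ N12 — THE ROOTED TOWER FOREST AT PRINT's DATUM `Λ_j(Z) = lamBondsSeq (maxDomT M₁ Z) k j` ([Balaban1984PropagatorsII] (2.3)): the tower-confined forest of dag-n12-w3's
# `…N12TowerForest(Words)` for an ARBITRARY root set, the print root set `R_Λ(Z) = {ι_j c± : c ∈ Λ_j(Z), j ≤ k}` (= the `Γ`-CENTRES: every `Γ_j^{(j)}`-centre is one, no face-layer point is),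
# and ★★★ `exists_towerForest_rooted_lamBondsSeq` — `…N12TowerForestRootsBj.exists_towerForest_rooted_Bj` at print roots with (CENTRE)ᴸᵃᵐ «`root z = ι_J(B^J z)` at EVERY site of
# `Γ`-level `J`» (no face layer) — the `path`∕`root` datum of the (σ)_N producer `B15Prop1GaugeLetterLocOfForestPackageB` and of `B15Prop1AxialGaugeSectionOfForest` at print's datum;
# (F)-share of the (ii) re-attachment (dag-lead WORDS 423, pub-ymgap INBOX 2026-08-30)

[Balaban1984PropagatorsII] = «[II]», (2.3) p. 224; [Balaban1988Convergent] = «[III]», (2.2) p. 255, (2.13) pp. 256–257; [Balaban1985RegularSpaces] = «[6]», (1.14) p. 78, (1.19) p. 79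
(the axial gauge `Ax_k(𝔅_k, U₀)` along a block-hierarchical tree rooted at the points of `𝔅_k`); [Balaban1985Variational] = «[15]», (3)–(4) p. 278, (16)–(18) p. 280; [Balaban1987RG1] = «[RG1]»,
(0.1)–(0.3) pp. 251–252 (block towers, centres).

Cell `pub-ymgap` (HUMAN RULINGS D-0062 ∕ D-0149), lane `pub-ymgap-dag-n12-c` g37 (R134 seat (a), N12 = [B15], s1, lane owner; (F)-share by dag-lead WORDS 423); `--kind proof --supports` K1⁹
`stmt-QuantumFields-27364` `--as helper`; count-neutral.  THEOREMS ONLY (0 `def`, 0 `instance`, 0 `sorry`); by name over dag-n12-w3's `…N12TowerForest` (`exists_forest_of_rankedParents`,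
`exists_parent_toward_centre`), `…N12TowerForestWords` (`exists_root_walk_word`, `iterBlockOf_root_eq_of_confined`, `root_eq_centre_of_uniqueRoot`), `…N12RootedForest.forest_F1`,
`…N12RootedForestGeodesic.tdist_embIter_iterBlockOf_le`, `…N12BjCollarRoots`, `…N12FlatHndRecordLetters.hcov_Bj`, `…N12FlatHndHarmonicLetter.not_wrap_of_iterBlockOf_shift_eq`, and this
lane's `B15DeterminingSetsBEndpoints` (✓p776611∕p776747: every `Γ_j^{(j)}`-site is an end of a `Λ_j`-bond; a `Λ_j`-bond has both end-centres off `Ω_{j+1}`) ∕ `…N12BjAcrossChainsLam`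
(`not_faceLayer_lamBondsSeq`).  §1 is the parents' proof text (tree bytes, block-extracted by `work/gen_towerforest_lam.py`) with the root set abstracted.

WHY.  The (σ)_N producer (`B15Prop1GaugeLetterLocOfForestPackage(B).exists_gaugeLetterLoc_atRecord_of_forestPackage`) and the axial-gauge section (`B15Prop1AxialGaugeSectionOfForest`) read a
ROOTED TOWER FOREST whose (F2) roots are the tower sites `ι_j c±` of the CONSTRAINED bonds — at print's datum, of `Λ_j(Z)`'s bonds: fewer bonds than the (b)-reading, hence FEWER roots
(the face-layer points `ι_{J−1}(B^{J−1}z)` under a `Γ_J`-block, reached in (b) through an inward connector, are no longer roots).  THIS FILE rebuilds the forest at the print root set and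
finds it SIMPLER: `R_Λ(Z)` is exactly the set of `Γ`-centres, the `J`-block of a site of `Γ`-level `J` contains exactly ONE root (its centre), so the root of every site is the centre of
its `Γ`-level block — (CENTRE) without the face-layer alternative; (TOWER)∕(LEN)∕(DISP)∕(ROOTBLK) at the `Γ`-level are the parent's, per-site budgets `ℓ_J = Σ_{i≤J}(d(Lⁱ−1)∕2+1)` unchanged.

CONTENTS (namespace `Summit.QuantumFields.YangMills.BalabanUVNodes.N12TowerForestLam`).  §1 arbitrary root set: ★★ `exists_towerForest_of_rootSet`, ★★ `exists_towerForest_words_of_rootSet`.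
§2 the print root set at `Z`'s maximal sequence: `embIter_eq_embIter_iterBlockOf_of_le` ∕ `_add` (a `j`-centre is the `J`-centre of its `J`-block, `J ≤ j`), ★ `centre_mem_rootSetLam` (every `Γ_J`-centre is a
print root), `exists_rootLevel_lam` (the cover letter), ★★ `eq_centre_of_mem_rootSetLam` (a print root in the `J`-block of a site of `Γ`-level `J` IS the centre: no root below the `Γ`-level,
none beside it).  §3 ★★★ `exists_towerForest_rooted_lamBondsSeq` ((F1), (F2) on `Λ`'s tower sites, (TREE), roots∕words, per rooted level (TOWER)(LEN)(DISP)(ROOTBLK), (Cov) site AND bond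
form, (CENTRE)ᴸᵃᵐ), ★★ `exists_towerForest_rooted_lamBondsSeq_hcentre` (the same with (CENTRE) in the parent's two-alternative shape read at print's datum — the drop-in for generator twins).

HONEST FRAMING.  Finite lattice combinatorics by name over landed kernel theorems; no analysis; nothing of Bałaban's estimates asserted or refuted; count-neutral helper
(`--supports 27364`); N12 NOT discharged; K0⁷∕K1⁹ NOT closed; counts of record unmoved (typed 28∕28 · discharged 8∕27); one finite 𝕋⁴ programme at fixed ε — R4 closes the
conditional rung `BalabanLadder.UV` only; the Yang–Mills mass gap (Clay) is NOT proved by any of this; nothing continuum ∕ ℝ⁴ ∕ OS.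
-/

noncomputable section

namespace Summit.QuantumFields.YangMills.BalabanUVNodes.N12TowerForestLam

open scoped BigOperators
open Literature.MathematicalPhysics.QuantumFieldTheory.Balaban1983to89
open T4Continuum
open B15DeterminingSets B15DeterminingSetsB
open B15DeterminingSetsBEndpoints (exists_mem_lamBondsSeq_maxDomT_of_mem_Bj embIter_not_mem_of_mem_lamBondsSeq)
open B5Eq118OneStroke (iterBlockOf iterBlockOf_succ val_iterBlockOf)
open B14.Eq213MaximalDomains (side)
open B14.Eq213DetSet (Bj Bj_zero Bj_mid Bj_top Bj_of_gt maxDomT maxDomT_antitone isBlockUnion_maxDomT)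
open Literature.MathematicalPhysics.QuantumFieldTheory.BalabanImbrieJaffe1984to88.BIJ88RT51Background (iterBlockOf_embIter embIter_succ)
open Summit.QuantumFields.YangMills.Theorems.Prop7TentInterpolation (val_embIter)
open Summit.QuantumFields.YangMills.Theorems.Prop7FlatHolonomy (sitesPerDir_zero_eq_mul_pow)
open Summit.QuantumFields.YangMills.BalabanUVNodes.N12RootedForest (forest_F1)
open Summit.QuantumFields.YangMills.BalabanUVNodes.N12RootedForestGeodesic (tdist_embIter_iterBlockOf_le)
open Summit.QuantumFields.YangMills.BalabanUVNodes.N07CritMultiScaleLamBond (iterBlockOf_congr_of_le)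
open Summit.QuantumFields.YangMills.BalabanUVNodes.N12TowerForest (exists_forest_of_rankedParents exists_parent_toward_centre)
open Summit.QuantumFields.YangMills.BalabanUVNodes.N12TowerForestWords (exists_root_walk_word iterBlockOf_root_eq_of_confined root_eq_centre_of_uniqueRoot)
open Summit.QuantumFields.YangMills.BalabanUVNodes.N12FlatHndHarmonicLetter (not_wrap_of_iterBlockOf_shift_eq)
open Summit.QuantumFields.YangMills.BalabanUVNodes.N12FlatHndRecordLetters (hcov_Bj)
open Summit.QuantumFields.YangMills.BalabanUVNodes.N12BjCollarRoots
open Summit.QuantumFields.YangMills.BalabanUVNodes.N12BjAcrossChainsLam (not_faceLayer_lamBondsSeq)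

variable {P : Params}

/-! ## §1  The tower-confined forest for an arbitrary root set -/

section RootSet

/-- ★★ **THE TOWER-CONFINED FOREST FOR AN ARBITRARY ROOT SET** — `N12TowerForest.exists_towerForest` with the root set `R ⊆ T_η` ABSTRACT (the parent instantiates `R := R(𝐁, k)`):
under the cover letter «every fine site has a level `n ≤ k` whose tower centre `ι_n(B^n z)` is a root» there is a rooted forest in the `path` currency with (F1), (F2) `path r = []` on `R`,
(TREE) at `R`, (TOWER) whenever the centre of the `j`-block of `z` is a root (`j ≤ k`) every step of `path z` has both ends in that block, (LEN) then `|path z| ≤ Σ_{i≤j}(d(Lⁱ−1)∕2+1)`.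
The parent's construction and proof text verbatim (tree bytes, `work/gen_towerforest_lam.py`): hang `z ∉ R` from the neighbour one unit closer to the centre of the LOWEST rooted block
of its tower, rank `tdist + Σ_{i<level}`. [cite: Balaban1985RegularSpaces, (1.14) p.78, (1.19) p.79; Balaban1985Variational, (4) p.278, (16)–(18) p.280; Balaban1988Convergent, (2.2) p.255, (2.13) pp.256–257; Balaban1987RG1, (0.1)–(0.3) pp.251–252] -/
theorem exists_towerForest_of_rootSet (R : Set (Site P 0)) {k : ℕ} (hk : k ≤ P.m + P.K) (hex : ∀ z : Site P 0, ∃ n, n ≤ k ∧ embIter n (iterBlockOf n z) ∈ R) :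
    ∃ path : Site P 0 → List (LStep P 0),
      (∀ x, ∀ s ∈ path x, ∃ x' x'' : Site P 0, path x'' = path x' ++ [s] ∧
        (s.fwd = true → s.bond.src = x' ∧ s.bond.tgt = x'') ∧ (s.fwd = false → s.bond.src = x'' ∧ s.bond.tgt = x')) ∧
      (∀ r ∈ R, path r = []) ∧
      (∀ x : Site P 0, x ∉ R →
        ∃ (x' : Site P 0) (s : LStep P 0), path x = path x' ++ [s] ∧
          (s.fwd = true → s.bond.src = x' ∧ s.bond.tgt = x) ∧ (s.fwd = false → s.bond.src = x ∧ s.bond.tgt = x')) ∧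
      (∀ (z : Site P 0) (j : ℕ), j ≤ k →
        embIter j (iterBlockOf j z) ∈ R →
        ∀ s ∈ path z, iterBlockOf j s.bond.src = iterBlockOf j z ∧ iterBlockOf j s.bond.tgt = iterBlockOf j z) ∧
      (∀ (z : Site P 0) (j : ℕ), j ≤ k →
        embIter j (iterBlockOf j z) ∈ R →
        (path z).length ≤ ∑ i ∈ Finset.range (j + 1), (P.d * ((P.L ^ i - 1) / 2) + 1)) := by
  classical
  -- the least root level of the tower of a site
  let nz : Site P 0 → ℕ := fun z => Nat.find (hex z)
  have hnz : ∀ z, nz z ≤ k ∧ embIter (nz z) (iterBlockOf (nz z) z) ∈ R := fun z => Nat.find_spec (hex z)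
  have hmin : ∀ z j, j ≤ k → embIter j (iterBlockOf j z) ∈ R → nz z ≤ j := fun z j hj hmem => Nat.find_min' (hex z) ⟨hj, hmem⟩
  -- the rank
  let S : ℕ → ℕ := fun n => ∑ i ∈ Finset.range n, (P.d * ((P.L ^ i - 1) / 2) + 1)
  have hS_succ : ∀ n, S (n + 1) = S n + (P.d * ((P.L ^ n - 1) / 2) + 1) := fun n => Finset.sum_range_succ _ n
  have hS_mono : ∀ {a b}, a ≤ b → S a ≤ S b := fun {a b} hab =>
    Finset.sum_le_sum_of_subset (Finset.range_subset_range.2 hab)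
  let ρ : Site P 0 → ℕ := fun z => Site.tdist z (embIter (nz z) (iterBlockOf (nz z) z)) + S (nz z)
  have hρle : ∀ z j, j ≤ k → embIter j (iterBlockOf j z) ∈ R → ρ z + 1 ≤ S (j + 1) := fun z j hj hmem => by
    have hn := hmin z j hj hmem
    have ht := tdist_embIter_iterBlockOf_le ((hnz z).1.trans hk) z
    have h1 : ρ z + 1 ≤ S (nz z + 1) := by
      show Site.tdist z (embIter (nz z) (iterBlockOf (nz z) z)) + S (nz z) + 1 ≤ S (nz z + 1)
      rw [hS_succ]; omega
    exact h1.trans (hS_mono (by omega))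
  -- ranked parents with the edge predicate «same `j`-block for every root level `j` of the child»
  obtain ⟨path, hroot, htree, hlen⟩ := exists_forest_of_rankedParents R ρ
    (fun x' x => ∀ j, j ≤ k → embIter j (iterBlockOf j x) ∈ R → iterBlockOf j x' = iterBlockOf j x) (fun x hxR => by
      obtain ⟨hnk, hmem⟩ := hnz x
      have hne : x ≠ embIter (nz x) (iterBlockOf (nz x) x) := fun h => hxR (h ▸ hmem)
      obtain ⟨x', l, hwalk, hblk, hdist⟩ := exists_parent_toward_centre (hnk.trans hk) hne
      have hmem' : embIter (nz x) (iterBlockOf (nz x) x') ∈ R := by rw [hblk]; exact hmem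
      have hn' : nz x' ≤ nz x := hmin x' (nz x) hnk hmem'
      refine ⟨x', l, ?_, hwalk, fun j hj hj' => iterBlockOf_congr_of_le (hmin x j hj hj') hblk⟩
      show Site.tdist x' (embIter (nz x') (iterBlockOf (nz x') x')) + S (nz x') < Site.tdist x (embIter (nz x) (iterBlockOf (nz x) x)) + S (nz x)
      rcases hn'.lt_or_eq with hlt | heq
      · have ht := tdist_embIter_iterBlockOf_le ((hnz x').1.trans hk) x'
        have h1 : Site.tdist x' (embIter (nz x') (iterBlockOf (nz x') x')) + S (nz x') + 1 ≤ S (nz x' + 1) := by rw [hS_succ]; omega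
        have h2 : S (nz x' + 1) ≤ S (nz x) := hS_mono (by omega)
        omega
      · rw [heq, hblk]
        omega)
  refine ⟨path, forest_F1 hroot (fun x hx => ?_), hroot,
    fun x hx => ?_, fun z j hj hmem => ?_, fun z j hj hmem => ?_⟩
  · obtain ⟨x', s, hpx, hor, -, -⟩ := htree x hx
    exact ⟨x', s, hpx, hor⟩
  · obtain ⟨x', s, hpx, hor, -, -⟩ := htree x hx
    exact ⟨x', s, hpx, hor⟩
  · -- (TOWER) by induction along the path
    have key : ∀ (n : ℕ) (z : Site P 0), (path z).length = n → embIter j (iterBlockOf j z) ∈ R →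
        ∀ s ∈ path z, iterBlockOf j s.bond.src = iterBlockOf j z ∧ iterBlockOf j s.bond.tgt = iterBlockOf j z := by
      intro n
      induction' n using Nat.strong_induction_on with n ih
      intro z hn hmemz s hs
      by_cases hzR : z ∈ R
      · rw [hroot z hzR] at hs
        simp at hs
      · obtain ⟨z', t, hpz, hor, hE, -⟩ := htree z hzR
        have hblk : iterBlockOf j z' = iterBlockOf j z := hE j hj hmemz
        rw [hpz, List.mem_append, List.mem_singleton] at hs
        rcases hs with hs | rfl
        · have hmemz' : embIter j (iterBlockOf j z') ∈ R := by rw [hblk]; exact hmemz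
          have hlt : (path z').length < n := by rw [← hn, hpz, List.length_append, List.length_singleton]; omega
          obtain ⟨h1, h2⟩ := ih _ hlt z' rfl hmemz' s hs
          exact ⟨h1.trans hblk, h2.trans hblk⟩
        · cases h : s.fwd
          · obtain ⟨hsrc, htgt⟩ := hor.2 h
            rw [hsrc, htgt]
            exact ⟨rfl, hblk⟩
          · obtain ⟨hsrc, htgt⟩ := hor.1 h
            rw [hsrc, htgt]
            exact ⟨hblk, rfl⟩
    exact key _ z rfl hmem
  · exact (Nat.le_succ_of_le (hlen z)).trans (hρle z j hj hmem)

/-- ★★ **THE TOWER-CONFINED FOREST IN WORD CURRENCY FOR AN ARBITRARY ROOT SET** — `N12TowerForestWords.exists_towerForest_words` with `R` abstract: §1a's forest with its root map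
(`root r = r` on `R`, `root x ∈ R`, `path x = walk (root x) (word x)`, `walkEnd (root x) (word x) = x`) and, for every root level `j ≤ k` of `z`, (TOWER), (LEN), (DISP) the true integer
displacement `netDisp (word z) ν = z̃_ν − root̃_ν`, (ROOTBLK) `B^j(root z) = B^j z` — the parent's proof text with the root set abstracted.
[cite: Balaban1985RegularSpaces, (1.19) p.79; Balaban1985Variational, (4) p.278, (16)–(18) p.280; Balaban1988Convergent, (2.2) p.255, (2.13) pp.256–257; Balaban1987RG1, (0.1)–(0.3) pp.251–252] -/
theorem exists_towerForest_words_of_rootSet (R : Set (Site P 0)) {k : ℕ} (hk : k ≤ P.m + P.K) (hex : ∀ z : Site P 0, ∃ n, n ≤ k ∧ embIter n (iterBlockOf n z) ∈ R) :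
    ∃ (path : Site P 0 → List (LStep P 0)) (root : Site P 0 → Site P 0),
      (∀ x, ∀ s ∈ path x, ∃ x' x'' : Site P 0, path x'' = path x' ++ [s] ∧
        (s.fwd = true → s.bond.src = x' ∧ s.bond.tgt = x'') ∧ (s.fwd = false → s.bond.src = x'' ∧ s.bond.tgt = x')) ∧
      (∀ r ∈ R, path r = []) ∧
      (∀ x : Site P 0, x ∉ R →
        ∃ (x' : Site P 0) (s : LStep P 0), path x = path x' ++ [s] ∧
          (s.fwd = true → s.bond.src = x' ∧ s.bond.tgt = x) ∧ (s.fwd = false → s.bond.src = x ∧ s.bond.tgt = x')) ∧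
      (∀ r ∈ R, root r = r) ∧
      (∀ x : Site P 0, root x ∈ R ∧
        path x = walk (root x) ((path x).map fun s => (s.bond.dir, s.fwd)) ∧ walkEnd (root x) ((path x).map fun s => (s.bond.dir, s.fwd)) = x) ∧
      (∀ (z : Site P 0) (j : ℕ), j ≤ k →
        embIter j (iterBlockOf j z) ∈ R →
        (∀ s ∈ path z, iterBlockOf j s.bond.src = iterBlockOf j z ∧ iterBlockOf j s.bond.tgt = iterBlockOf j z) ∧
        (path z).length ≤ ∑ i ∈ Finset.range (j + 1), (P.d * ((P.L ^ i - 1) / 2) + 1) ∧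
        (∀ ν, netDisp ((path z).map fun s => (s.bond.dir, s.fwd)) ν = ((z ν).val : ℤ) - ((root z ν).val : ℤ)) ∧
        iterBlockOf j (root z) = iterBlockOf j z) := by
  obtain ⟨path, hF1, hroot, htree, htower, hlen⟩ := exists_towerForest_of_rootSet R hk hex
  obtain ⟨root, hrootR, hw⟩ := exists_root_walk_word hroot htree
  refine ⟨path, root, hF1, hroot, htree, hrootR, fun x => ⟨(hw x).1, (hw x).2.1, (hw x).2.2.1⟩, fun z j hj hmem => ⟨htower z j hj hmem, hlen z j hj hmem, ?_,
    iterBlockOf_root_eq_of_confined (hw z).2.1 (hw z).2.2.1 (htower z j hj hmem)⟩⟩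
  -- no step of `path z` wraps: both ends of every step lie in the `j`-block of `z`
  refine (hw z).2.2.2 fun s hs => ?_
  obtain ⟨hsrc, htgt⟩ := htower z j hj hmem s hs
  exact not_wrap_of_iterBlockOf_shift_eq (hj.trans hk) s.bond.src s.bond.dir (htgt.trans hsrc.symm)

end RootSet

/-! ## §2  The print root set at `Z`'s maximal sequence: the `Γ`-centres -/

section PrintRoots

variable {M₁ k : ℕ} {Z : Set (Site P 0)}

/-- A `(J+d)`-centre is the `J`-centre of its own `J`-block: `ι_{J+d} y = ι_J(B^J(ι_{J+d} y))` (`ι_{n+1} B = ι_n(emb B)` and `B^J ∘ ι_J = id`). [cite: Balaban1987RG1, (0.1)–(0.3) pp.251–252 (bookkeeping)] -/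
theorem embIter_eq_embIter_iterBlockOf_add (J : ℕ) : ∀ (d : ℕ) (y : Site P (J + d)), J + d ≤ P.m + P.K →
    embIter (J + d) y = embIter J (iterBlockOf J (embIter (J + d) y))
  | 0, y, hJ => by
    show embIter J y = embIter J (iterBlockOf J (embIter J y))
    rw [iterBlockOf_embIter J hJ]
  | d + 1, y, hJ => by
    show embIter (J + d) (emb y) = embIter J (iterBlockOf J (embIter (J + d) (emb y)))
    exact embIter_eq_embIter_iterBlockOf_add J d (emb y) (by omega)

/-- A `j`-centre is the `J`-centre of its own `J`-block for every `J ≤ j` (the same fact, in another binder shape and namespace, is k0-s1-w1's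
`…K0Stub1TouchedCentresOfDomains.embIter_eq_embIter_iterBlockOf`; re-proved here in three lines to keep this module's import closure inside N12). [cite: Balaban1987RG1, (0.1)–(0.3) pp.251–252 (bookkeeping)] -/
theorem embIter_eq_embIter_iterBlockOf_of_le {J j : ℕ} (hJj : J ≤ j) (hj : j ≤ P.m + P.K) (y : Site P j) :
    embIter j y = embIter J (iterBlockOf J (embIter j y)) := by
  obtain ⟨d, rfl⟩ : ∃ d, j = J + d := ⟨j - J, by omega⟩
  exact embIter_eq_embIter_iterBlockOf_add J d y hj

/-- ★ **EVERY `Γ_J`-CENTRE IS A PRINT ROOT**: if the `J`-block of `z` is a member of `𝐁_k(Z)` then its centre `ι_J(B^J z)` is a tower site of a bond of `Λ_J(Z)` (this lane's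
`B15DeterminingSetsBEndpoints.exists_mem_lamBondsSeq_maxDomT_of_mem_Bj`: every `Γ_J^{(J)}`-site is an end of a `Λ_J`-bond). [cite: Balaban1984PropagatorsII, (2.3) p.224; Balaban1988Convergent, (2.2) p.255, (2.13) pp.256–257] -/
theorem centre_mem_rootSetLam (hM : 1 ≤ M₁) (hdiv : side P.L M₁ k ∣ P.sitesPerDir 0) (hk : k ≤ P.m + P.K) {J : ℕ} {z : Site P 0}
    (hz : iterBlockOf J z ∈ (Bj M₁ Z k : DetSet P) J) :
    embIter J (iterBlockOf J z) ∈ {z : Site P 0 | ∃ j, j ≤ k ∧ ∃ c ∈ lamBondsSeq (maxDomT M₁ Z) k j, (z = embIter j c.src ∨ z = embIter j c.tgt)} := by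
  obtain ⟨c, hc, hcz⟩ := exists_mem_lamBondsSeq_maxDomT_of_mem_Bj hM Z hk hdiv hz
  refine ⟨J, le_of_iterBlockOf_mem_Bj hz, c, hc, ?_⟩
  rcases hcz with h | h
  · exact Or.inl (by rw [h])
  · exact Or.inr (by rw [h])

/-- **THE COVER LETTER AT PRINT ROOTS**: every fine site has a level `n ≤ k` (its `Γ`-level, `hcov_Bj`) whose tower centre is a print root. [cite: Balaban1988Convergent, (2.2) p.255, (2.13) pp.256–257] -/
theorem exists_rootLevel_lam (hM : 1 ≤ M₁) (hk1 : 1 ≤ k) (hk : k ≤ P.m + P.K) (hdiv : side P.L M₁ k ∣ P.sitesPerDir 0) (z : Site P 0) :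
    ∃ n, n ≤ k ∧ embIter n (iterBlockOf n z) ∈ {z : Site P 0 | ∃ j, j ≤ k ∧ ∃ c ∈ lamBondsSeq (maxDomT M₁ Z) k j, (z = embIter j c.src ∨ z = embIter j c.tgt)} := by
  obtain ⟨J, hJk, hJ⟩ := hcov_Bj hM hk1 hk hdiv (Z := Z) z
  exact ⟨J, hJk, centre_mem_rootSetLam hM hdiv hk hJ⟩

/-- ★★ **A PRINT ROOT IN THE `Γ`-LEVEL BLOCK OF A SITE IS ITS CENTRE**: if the `J`-block of `z` is a member (`J ≥ 1`) and `r ∈ R_Λ(Z)` lies in that block (`B^J r = B^J z`), then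
`r = ι_J(B^J z)`.  For `r = ι_j c±`, `c ∈ Λ_j(Z)`: `j < J` is impossible (the end's `(j+1)`-block would lie in `Ω_{j+1} ⊇ Ω_J` with `z` — an inward connector's end, excluded by [II] (2.3));
for `j ≥ J` a `j`-centre is the `J`-centre of its `J`-block. [cite: Balaban1984PropagatorsII, (2.3) p.224; Balaban1988Convergent, (2.2) p.255, (2.13) pp.256–257; Balaban1987RG1, (0.1)–(0.3) pp.251–252] -/
theorem eq_centre_of_mem_rootSetLam (hM : 1 ≤ M₁) (hdiv : side P.L M₁ k ∣ P.sitesPerDir 0) (hk : k ≤ P.m + P.K) {J : ℕ} (hJ1 : 1 ≤ J) {z : Site P 0}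
    (hz : iterBlockOf J z ∈ (Bj M₁ Z k : DetSet P) J) {r : Site P 0}
    (hr : r ∈ {z : Site P 0 | ∃ j, j ≤ k ∧ ∃ c ∈ lamBondsSeq (maxDomT M₁ Z) k j, (z = embIter j c.src ∨ z = embIter j c.tgt)})
    (hblk : iterBlockOf J r = iterBlockOf J z) : r = embIter J (iterBlockOf J z) := by
  have hJk : J ≤ k := le_of_iterBlockOf_mem_Bj hz
  obtain ⟨j, hjk, c, hc, hrc⟩ := hr
  -- `r = ι_j y` for an end `y` of `c`
  obtain ⟨y, hy, rfl⟩ : ∃ y : Site P j, (y = c.src ∨ y = c.tgt) ∧ r = embIter j y := by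
    rcases hrc with h | h
    · exact ⟨c.src, Or.inl rfl, h⟩
    · exact ⟨c.tgt, Or.inr rfl, h⟩
  by_cases hjJ : J ≤ j
  · -- a `j`-centre is the `J`-centre of its `J`-block
    rw [← hblk]
    exact embIter_eq_embIter_iterBlockOf_of_le hjJ (hjk.trans hk) y
  · -- `j < J`: the end `y` of `c ∈ Λ_j` has its centre in the `J`-block of `z`, hence in `Ω_J ⊆ Ω_{j+1}` — an inward connector, excluded
    exfalso
    have hjJ' : j < J := not_le.mp hjJ
    have hzΩ : z ∈ maxDomT M₁ Z J := mem_maxDomT_of_iterBlockOf_mem_Bj hM hdiv hk hJ1 hz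
    have hrΩ : embIter j y ∈ maxDomT M₁ Z J := (mem_maxDomT_iff_of_iterBlockOf_eq hM hdiv hk hJ1 hJk le_rfl hblk).2 hzΩ
    have hrΩ' : embIter j y ∈ maxDomT M₁ Z (j + 1) := maxDomT_antitone hM Z (Nat.succ_le_of_lt hjJ') hrΩ
    obtain ⟨hs, ht⟩ := embIter_not_mem_of_mem_lamBondsSeq (maxDomT M₁ Z) hk (lt_of_lt_of_le hjJ' hJk)
      (isBlockUnion_maxDomT hM (Ω := Z) hdiv (by omega) (by omega) (by omega)) hc
    rcases hy with rfl | rfl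
    · exact hs hrΩ'
    · exact ht hrΩ'

end PrintRoots

/-! ## §3  The rooted tower forest at print's datum -/

section Rooted

variable {M₁ k : ℕ} {Z : Set (Site P 0)}

/-- ★★★ **THE ROOTED TOWER FOREST AT PRINT's DATUM `Λ(Z)`** (`1 ≤ k ≤ m + K`, `M₁ ≥ 1`, cover divisibility): a rooted forest `path` of the fine torus with root set `R_Λ(Z) = {ι_j c± : c ∈ Λ_j(Z),
j ≤ k}` and its root map `root`: (F1); (F2) `path (ι_j c±) = []` for every `c ∈ Λ_j(Z)`, `j ≤ k`; (TREE) at `R_Λ(Z)`; `root r = r` on `R_Λ(Z)`; `root x ∈ R_Λ(Z)`, `path x = walk (root x) (word x)`,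
`walkEnd (root x) (word x) = x`; for every ROOTED level `j ≤ k` of a site (`ι_j(B^j z) ∈ R_Λ(Z)`): (TOWER), (LEN) `|path z| ≤ Σ_{i≤j}(d(Lⁱ−1)∕2+1)`, (DISP), (ROOTBLK); (Cov) every site has a
member level `J ≤ k` (`B^J z ∈ 𝐁_k(Z)_J`) AND a bond-level witness (`B^J z` an end of a `Λ_J(Z)`-bond); ★ (CENTRE)ᴸᵃᵐ: for a site `z` of `Γ`-level `J`, `root z = ι_J(B^J z)` — the centre
of its `Γ`-level block, with NO face-layer alternative ([II] (2.3) drops the inward connectors; `eq_centre_of_mem_rootSetLam`).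
[cite: Balaban1984PropagatorsII, (2.3) p.224; Balaban1988Convergent, (2.2) p.255, (2.13) pp.256–257; Balaban1985Variational, (3)–(4) p.278, (16)–(18) p.280; Balaban1985RegularSpaces, (1.19) p.79; Balaban1987RG1, (0.1)–(0.3) pp.251–252] -/
theorem exists_towerForest_rooted_lamBondsSeq (hk : k ≤ P.m + P.K) (hk1 : 1 ≤ k) (hM : 1 ≤ M₁) (hdiv : side P.L M₁ k ∣ P.sitesPerDir 0) :
    ∃ (path : Site P 0 → List (LStep P 0)) (root : Site P 0 → Site P 0),
      (∀ x, ∀ s ∈ path x, ∃ x' x'' : Site P 0, path x'' = path x' ++ [s] ∧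
        (s.fwd = true → s.bond.src = x' ∧ s.bond.tgt = x'') ∧ (s.fwd = false → s.bond.src = x'' ∧ s.bond.tgt = x')) ∧
      (∀ j, j ≤ k → ∀ c ∈ lamBondsSeq (maxDomT M₁ Z) k j, path (embIter j c.src) = [] ∧ path (embIter j c.tgt) = []) ∧
      (∀ x : Site P 0, x ∉ {z : Site P 0 | ∃ j, j ≤ k ∧ ∃ c ∈ lamBondsSeq (maxDomT M₁ Z) k j, (z = embIter j c.src ∨ z = embIter j c.tgt)} →
        ∃ (x' : Site P 0) (s : LStep P 0), path x = path x' ++ [s] ∧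
          (s.fwd = true → s.bond.src = x' ∧ s.bond.tgt = x) ∧ (s.fwd = false → s.bond.src = x ∧ s.bond.tgt = x')) ∧
      (∀ r ∈ {z : Site P 0 | ∃ j, j ≤ k ∧ ∃ c ∈ lamBondsSeq (maxDomT M₁ Z) k j, (z = embIter j c.src ∨ z = embIter j c.tgt)}, root r = r) ∧
      (∀ x : Site P 0, root x ∈ {z : Site P 0 | ∃ j, j ≤ k ∧ ∃ c ∈ lamBondsSeq (maxDomT M₁ Z) k j, (z = embIter j c.src ∨ z = embIter j c.tgt)} ∧
        path x = walk (root x) ((path x).map fun s => (s.bond.dir, s.fwd)) ∧ walkEnd (root x) ((path x).map fun s => (s.bond.dir, s.fwd)) = x) ∧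
      (∀ (z : Site P 0) (j : ℕ), j ≤ k →
        embIter j (iterBlockOf j z) ∈ {z : Site P 0 | ∃ j, j ≤ k ∧ ∃ c ∈ lamBondsSeq (maxDomT M₁ Z) k j, (z = embIter j c.src ∨ z = embIter j c.tgt)} →
        (∀ s ∈ path z, iterBlockOf j s.bond.src = iterBlockOf j z ∧ iterBlockOf j s.bond.tgt = iterBlockOf j z) ∧
        (path z).length ≤ ∑ i ∈ Finset.range (j + 1), (P.d * ((P.L ^ i - 1) / 2) + 1) ∧
        (∀ ν, netDisp ((path z).map fun s => (s.bond.dir, s.fwd)) ν = ((z ν).val : ℤ) - ((root z ν).val : ℤ)) ∧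
        iterBlockOf j (root z) = iterBlockOf j z) ∧
      (∀ z : Site P 0, ∃ J, J ≤ k ∧ iterBlockOf J z ∈ (Bj M₁ Z k : DetSet P) J ∧
        ∃ c ∈ lamBondsSeq (maxDomT M₁ Z) k J, (iterBlockOf J z = c.src ∨ iterBlockOf J z = c.tgt)) ∧
      (∀ (z : Site P 0) (J : ℕ), iterBlockOf J z ∈ (Bj M₁ Z k : DetSet P) J → root z = embIter J (iterBlockOf J z)) := by
  classical
  set R : Set (Site P 0) := {z : Site P 0 | ∃ j, j ≤ k ∧ ∃ c ∈ lamBondsSeq (maxDomT M₁ Z) k j, (z = embIter j c.src ∨ z = embIter j c.tgt)} with hR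
  obtain ⟨path, root, hF1, hF2R, htree, hrootR, hw, htower⟩ := exists_towerForest_words_of_rootSet R hk (exists_rootLevel_lam hM hk1 hk hdiv)
  refine ⟨path, root, hF1, fun j hj c hc => ⟨hF2R _ ⟨j, hj, c, hc, Or.inl rfl⟩, hF2R _ ⟨j, hj, c, hc, Or.inr rfl⟩⟩, htree, hrootR, hw, htower, fun z => ?_, fun z J hz => ?_⟩
  · obtain ⟨J, hJk, hJ⟩ := hcov_Bj hM hk1 hk hdiv (Z := Z) z
    obtain ⟨c, hc, hcz⟩ := exists_mem_lamBondsSeq_maxDomT_of_mem_Bj hM Z hk hdiv hJ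
    exact ⟨J, hJk, hJ, c, hc, hcz.imp Eq.symm Eq.symm⟩
  · -- (CENTRE)ᴸᵃᵐ: the `J`-block of `z` is rooted at its centre and contains no other root
    have hJk : J ≤ k := le_of_iterBlockOf_mem_Bj hz
    have hmem : embIter J (iterBlockOf J z) ∈ R := centre_mem_rootSetLam hM hdiv hk hz
    rcases Nat.eq_zero_or_pos J with hJ0 | hJ1
    · -- level `0`: `z` itself is the centre of its `0`-block, a root
      subst hJ0
      exact hrootR z hmem
    · exact root_eq_centre_of_uniqueRoot (hw z).1 (htower z J hJk hmem).2.2.2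
        (fun r hr hrb => eq_centre_of_mem_rootSetLam hM hdiv hk hJ1 hz hr hrb)

/-- ★★ **THE SAME FOREST WITH (CENTRE) IN THE PARENT's TWO-ALTERNATIVE SHAPE READ AT PRINT's DATUM** — the drop-in for the generator twins of `…N12TowerForestRootsBj.exists_towerForest_rooted_Bj`'s
consumers (`bondsOf (𝐁_k(Z)_j) ↦ Λ_j(Z)` everywhere): the face-layer alternative never fires (`…N12BjAcrossChainsLam.not_faceLayer_lamBondsSeq`), so the clause is its second branch.  `M₁ ≥ 2`.
[cite: Balaban1984PropagatorsII, (2.3) p.224; Balaban1988Convergent, (2.2) p.255, (2.13) pp.256–257; Balaban1985Variational, (3)–(4) p.278, (16)–(18) p.280; Balaban1985RegularSpaces, (1.19) p.79; Balaban1987RG1, (0.1)–(0.3) pp.251–252] -/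
theorem exists_towerForest_rooted_lamBondsSeq_hcentre (hk : k ≤ P.m + P.K) (hk1 : 1 ≤ k) (hM2 : 2 ≤ M₁) (hdiv : side P.L M₁ k ∣ P.sitesPerDir 0) :
    ∃ (path : Site P 0 → List (LStep P 0)) (root : Site P 0 → Site P 0),
      (∀ x, ∀ s ∈ path x, ∃ x' x'' : Site P 0, path x'' = path x' ++ [s] ∧
        (s.fwd = true → s.bond.src = x' ∧ s.bond.tgt = x'') ∧ (s.fwd = false → s.bond.src = x'' ∧ s.bond.tgt = x')) ∧
      (∀ j, j ≤ k → ∀ c ∈ lamBondsSeq (maxDomT M₁ Z) k j, path (embIter j c.src) = [] ∧ path (embIter j c.tgt) = []) ∧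
      (∀ x : Site P 0, x ∉ {z : Site P 0 | ∃ j, j ≤ k ∧ ∃ c ∈ lamBondsSeq (maxDomT M₁ Z) k j, (z = embIter j c.src ∨ z = embIter j c.tgt)} →
        ∃ (x' : Site P 0) (s : LStep P 0), path x = path x' ++ [s] ∧
          (s.fwd = true → s.bond.src = x' ∧ s.bond.tgt = x) ∧ (s.fwd = false → s.bond.src = x ∧ s.bond.tgt = x')) ∧
      (∀ r ∈ {z : Site P 0 | ∃ j, j ≤ k ∧ ∃ c ∈ lamBondsSeq (maxDomT M₁ Z) k j, (z = embIter j c.src ∨ z = embIter j c.tgt)}, root r = r) ∧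
      (∀ x : Site P 0, root x ∈ {z : Site P 0 | ∃ j, j ≤ k ∧ ∃ c ∈ lamBondsSeq (maxDomT M₁ Z) k j, (z = embIter j c.src ∨ z = embIter j c.tgt)} ∧
        path x = walk (root x) ((path x).map fun s => (s.bond.dir, s.fwd)) ∧ walkEnd (root x) ((path x).map fun s => (s.bond.dir, s.fwd)) = x) ∧
      (∀ (z : Site P 0) (j : ℕ), j ≤ k →
        embIter j (iterBlockOf j z) ∈ {z : Site P 0 | ∃ j, j ≤ k ∧ ∃ c ∈ lamBondsSeq (maxDomT M₁ Z) k j, (z = embIter j c.src ∨ z = embIter j c.tgt)} →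
        (∀ s ∈ path z, iterBlockOf j s.bond.src = iterBlockOf j z ∧ iterBlockOf j s.bond.tgt = iterBlockOf j z) ∧
        (path z).length ≤ ∑ i ∈ Finset.range (j + 1), (P.d * ((P.L ^ i - 1) / 2) + 1) ∧
        (∀ ν, netDisp ((path z).map fun s => (s.bond.dir, s.fwd)) ν = ((z ν).val : ℤ) - ((root z ν).val : ℤ)) ∧
        iterBlockOf j (root z) = iterBlockOf j z) ∧
      (∀ z : Site P 0, ∃ J, J ≤ k ∧ iterBlockOf J z ∈ (Bj M₁ Z k : DetSet P) J) ∧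
      (∀ (z : Site P 0) (J : ℕ), iterBlockOf J z ∈ (Bj M₁ Z k : DetSet P) J →
        ((1 ≤ J ∧ ∃ c ∈ lamBondsSeq (maxDomT M₁ Z) k (J - 1), (iterBlockOf (J - 1) z = c.src ∨ iterBlockOf (J - 1) z = c.tgt)) ∧
            root z = embIter (J - 1) (iterBlockOf (J - 1) z)) ∨
        (¬ (1 ≤ J ∧ ∃ c ∈ lamBondsSeq (maxDomT M₁ Z) k (J - 1), (iterBlockOf (J - 1) z = c.src ∨ iterBlockOf (J - 1) z = c.tgt)) ∧
            root z = embIter J (iterBlockOf J z))) := by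
  have hM : 1 ≤ M₁ := by omega
  obtain ⟨path, root, hF1, hF2, htree, hrootR, hw, htower, hcov, hcentre⟩ := exists_towerForest_rooted_lamBondsSeq (Z := Z) hk hk1 hM hdiv
  refine ⟨path, root, hF1, hF2, htree, hrootR, hw, htower, fun z => ?_, fun z J hz => Or.inr ⟨?_, hcentre z J hz⟩⟩
  · obtain ⟨J, hJk, hJ, -⟩ := hcov z
    exact ⟨J, hJk, hJ⟩
  · -- no face layer at print's datum
    rcases Nat.eq_zero_or_pos J with hJ0 | hJ0
    · rintro ⟨h1, -⟩; omega
    · exact not_faceLayer_lamBondsSeq hM2 hdiv hk hJ0 hz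

end Rooted

end Summit.QuantumFields.YangMills.BalabanUVNodes.N12TowerForestLam

end
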